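import Summits.BirchSwinnertonDyer.BirchSwinnertonDyer.Theorems.SmallImageMuTransferMuTransferOfFineZetaContra
import Literature.NumberTheory.EllipticCurves.Kato2004.ZetaSideInputsContragredient
import Literature.NumberTheory.EllipticCurves.IwasawaAlgebraProofs
import HarnessLib

/-!
# The crux `MuTransfer` (stmt-BirchSwinnertonDyer-19629) BY NAME modulo the PRINT-EXACT contragredient ZETA SIDE
# ZSᶜ = `Kato2004.exists_zetaSideInputs_contra` ALONE — the true-size, print-exact published input of the crux

Cell `bsd-smallim` (rung K6 of `BirchSwinnertonDyer`, class X9), seat `bsd-line-k6-p2` gen 4 (D-0154 KEY (146) row 9;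
line `f1_fine` of `Cruxes/MuTransfer`).  HONEST FRAMING: THEOREMS ONLY; proves no case of BSD and closes no item — 19629
stays OPEN by design; the deciding theorems are CONDITIONAL on ONE named published CONSTRUCTION fact (the gate records
`conditional-result`).  PARTITION (D-0054): X9 (A4) and the surjective good-ordinary rows — types-the-object-of; closes NONE.

## What is new

Of record (this seat gen 4, p615445): `Theorems.smallImageMuTransfer_MuTransfer_of_fineZetaContra : F1ᶜ → MuTransfer`, F1ᶜ =
`Kato2004.exists_divisibilityInputs_fineQuotient_zeta_contra` — the whole print-exact §17.13 package (30 fields: Thm. 12.4 (1),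
12.5 (2)–(4), 12.6, 16.6 (2), 17.4 (2), Prop. 17.11, (17.13.1)–(17.13.4), p. 280, fine quotient).  As gens 0–2 showed for the
γ-keyed packages, the μ-road touches only the ZETA SIDE: `loc`, `toX`, `exact_P`, `col`, `col_injective`, `Z` + span clause,
the fine quotient `π`, and the p. 280 clause AT `(p)`.  The print-exact zeta-side twin ZSᶜ = `Kato2004.exists_zetaSideInputs_contra`
(file `Kato2004/ZetaSideInputsContragredient`, this seat gen 4) types exactly that; F1ᶜ ⟹ ZSᶜ
(`Kato2004.exists_zetaSideInputs_contra_of_fineQuotient_zeta_contra`).  THIS FILE: §1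
`…lengthAt_selmerDual_eq_zero_of_irr_of_zetaSideContra` (`X(E/ℚ_∞)_(p) = 0` for every γ-keyed datum, modulo ZSᶜ), §2
`…mu_eq_zero_of_irr_of_zetaSideContra` (`D.mu = 0`), §3 the junk-immunity certificates of gen 3 re-keyed on ZSᶜ
(`D.IsTorsion`; `Module.Finite ℤ_[p]` of `RestrictScalars ℤ_[p] Λ X` = Greenberg's form of `μ = 0`), §4
**`smallImageMuTransfer_MuTransfer_of_zetaSideContra : ZSᶜ → MuTransfer`** — the crux BY NAME modulo the zeta side alone,
duals contragredient; so Kato's Euler-system DIVISIBILITY theorems (12.4, 12.5 (2)–(4), 13.4, 17.4, (17.13.2)/(17.13.4)) are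
out of the cone of the WHOLE crux AND the remaining input is print-exact (ARM-P R-48, flag `Kato-1713-dual-action`).  Proof =
p615445's §2 over the sub-package: twist `D ↦ D′`, `Y ↦ Y′` (T-TWIST-SEL-1 / fine twist), ZSᶜ at `(𝐇¹_γ, D′, Y′)`, GV Prop. 3.7 +
certificate, `ZetaSideInputsContra.exists_isEulerSystemClass_notMem`, the γ-keyed image-facts core, `Sel₀[p]` finite ⟹
`length_(p) Y′.X = 0`, `ZetaSideInputsContra.lengthAt_X_le_lengthAt_fine`, the ι-fixed prime `(p)`.  CONDITIONAL on ZSᶜ;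
nothing asserted about any curve; BSD is not advanced.  (The comparison F1ᶜ ⟹ ZSᶜ ⟹ crux is recorded in the line's
skeleton `Cruxes/MuTransfer/Lines/f1_fine.lean`, not here: as a theorem it would restate p615445's type.)

References (locators only): K. Kato, Astérisque 295 (2004) Thm. 12.5 (1), 12.6, Ex. 13.3, (14.9.3), Thm. 16.6 (2), §17.3,
17.5, Prop. 17.11, §17.13 [Kato2004Asterisque]; R. Greenberg, V. Vatsal, Invent. Math. 142 (2000) Prop. 3.7 [GreenbergVatsal2000];
R. Greenberg, Adv. Stud. Pure Math. 17 (1989) pp. 101–102 (`S^ι`) [Greenberg1989]; L. Washington, *Introduction to Cyclotomic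
Fields*, §13.2 [Washington1997].
-/

-- the summit and its single problem are both named `BirchSwinnertonDyer` (registry layout D-0017)
set_option linter.dupNamespace false
set_option autoImplicit false

noncomputable section

open scoped Classical MatrixGroups ModularForm NumberField
open CongruenceSubgroup WeierstrassCurve Field IsDedekindDomain
open Literature.NumberTheory.GaloisRepresentations
open Literature.NumberTheory.EllipticCurves Literature.NumberTheory.EllipticCurves.ModularForms
open Literature.NumberTheory.EllipticCurves.Kato2004
open Literature.NumberTheory.EllipticCurves.Kato2004.EulerSystemValues
open Literature.NumberTheory.EllipticCurves.Rank1Residual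
open Summit.BirchSwinnertonDyer.BirchSwinnertonDyer.Rank1Residual
open Summit.BirchSwinnertonDyer.BirchSwinnertonDyer.Theses.SmallImageMuTransfer

namespace Summit.BirchSwinnertonDyer.BirchSwinnertonDyer.Theorems

open Module

/-! ## §1 `X(E/ℚ_∞)_(p) = 0` at every odd good ordinary prime with `E[p]` irreducible — ANY image — from the print-exact ZSᶜ -/

/-- **`length_(p) X(E/ℚ_∞) = 0` for every γ-keyed cyclotomic dual Selmer datum, at every ODD good ordinary prime with `E[p]`
irreducible — `ρ̄_{E,p}` onto or not, CM or not — given one unit coefficient of `L_p(f, α)`, modulo the PRINT-EXACT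
contragredient ZETA SIDE ZSᶜ ALONE** (`Kato2004.exists_zetaSideInputs_contra`).  The genuine local-length statement behind
`D.mu = 0` (`muInvariant = (length_(p)).toNat`).  Proof: twist `D ↦ D′ : W.SelmerDualData κ γ⁻¹` and a fine dual `Y ↦ Y′`
(T-TWIST-SEL-1 / fine twist; `Λ`-finiteness transported), ZSᶜ at `(𝐇¹_γ, D′, Y′)`, GV Prop. 3.7 + the certificate
(`G₁ ∉ (p)`), a GENUINE Euler-system class outside `p𝐇¹` (`ZetaSideInputsContra.exists_isEulerSystemClass_notMem`), the
γ-keyed image-facts core (`Sel₀(ℚ_∞, E[p^∞])[p]` killed by a power of `T`), `length_(p) Y′.X = 0`,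
`ZetaSideInputsContra.lengthAt_X_le_lengthAt_fine`, and back through the ι-fixed prime `(p)`
(`IwasawaAlgebra.comap_invol_eq_self_of_asIdeal_eq_augIdealP`).  Conditional on ZSᶜ only; nothing asserted.
[cite: Kato2004Asterisque, Thm. 12.6 (p. 222), Ex. 13.3 (p. 225), §13.8 (pp. 228–229), (14.9.3) (p. 240), Thm. 16.6 (2) (p. 271), §17.3 (p. 273), Prop. 17.11 (p. 277) and §17.13 (pp. 279–280)]
[cite: GreenbergVatsal2000, Prop. 3.7] [cite: Greenberg1989, §0 pp. 101–102 (S^ι)] [cite: Washington1997, §13.2] -/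
theorem smallImageMuTransfer_lengthAt_selmerDual_eq_zero_of_irr_of_zetaSideContra (hZSc : exists_zetaSideInputs_contra) :
    ∀ (W : WeierstrassCurve ℚ) [W.IsElliptic] [W.IsGloballyMinimal] (p : ℕ) [Fact p.Prime]
      {N : ℕ} [NeZero N] (f : CuspForm (Gamma0 N) 2),
      p ≠ 2 → W.HasGoodReductionAtPrime p → ¬ (p : ℤ) ∣ W.frobeniusTrace p →
      W.HasIrreducibleModPGaloisRep p → IsNewformOf W f →
      (∃ n : ℕ, ‖PowerSeries.coeff n (padicLFunction f (unitRoot W p : ℚ_[p]))‖ = 1) →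
      ∀ (κ : ZpExtension ℚ p) (γ : absoluteGaloisGroup ℚ),
        κ.IsCyclotomic → κ.IsTopGenerator γ → IsCyclotomicVariable p γ →
        ∀ D : W.SelmerDualData κ γ,
          Module.lengthAt (IwasawaAlgebra p) D.X
            ⟨IwasawaAlgebra.augIdealP p, IwasawaAlgebra.isPrime_augIdealP_holds p⟩ = 0 := by
  intro W _ _ p _ N _ f hp2 hgood hap hirr hf hcert κ γ hκ hγ hγ' D
  haveI : ContinuousSMul ℤ_[p] (W.tateModule p) := TateModule.continuousSMul_padicInt
  haveI : Module.Free ℤ_[p] (W.tateModule p) := W.module_free_tateModule_holds p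
  haveI : Module.Finite ℤ_[p] (W.tateModule p) := W.module_finite_tateModule_holds p
  have hord : IsOrdinaryAt W p := ⟨hgood, hap⟩
  -- the image facts (SC)/(IF), onto or not
  have hSC := exists_smul_eq_val_smul_of_irreducible_of_ne_two W p hp2 hirr
  have hIF := forall_normal_index_ne_of_irreducible_of_ne_two W p hp2 hirr
  -- the pinned modules: `𝐇¹_Γ(T_pW)` (γ-keyed) and a dual fine Selmer datum (γ-keyed)
  obtain ⟨I⟩ := nonempty_iwasawaH1Data_holds W p κ γ hκ hγ
  obtain ⟨Y⟩ := W.nonempty_fineSelmerDualData κ hγ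
  haveI : Module.Finite (IwasawaAlgebra p) D.X :=
    WeierstrassCurve.SelmerDualData.module_finite_of_isCyclotomic W κ hκ D hγ
  -- TWIST both duals to the CONTRAGREDIENT `Λ`-structure
  obtain ⟨D', eD, heD, -, -, -, hlenD, hfinD⟩ :=
    SignedKatoOffTwo.IwasawaInvolution.exists_twist_selmerDualData_invol_of_mul_inv D
  obtain ⟨Y', eY, heY, -, -, -, -⟩ :=
    SignedKatoOffTwo.IwasawaInvolution.exists_twist_fineSelmerDualData_invol (mul_inv_cancel γ) Y
  haveI : Module.Finite (IwasawaAlgebra p) D'.X := hfinD.mp inferInstance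
  -- the print-exact zeta-side package for `(𝐇¹_γ, D′, Y′)`
  obtain ⟨K⟩ := hZSc W p f κ γ hp2 hord hκ hγ hγ' hf I D' Y'
  haveI : Module.Finite (IwasawaAlgebra p) Y'.X := Module.Finite.of_surjective K.π K.π_surjective
  -- `L_p ∈ Λ` (GV Prop. 3.7) and the certificate: `G₁ ∉ (p)`
  obtain ⟨G₁, hG₁⟩ := exists_iwasawaToPowerSeries_eq_padicLFunction hp2 hord hf hirr
  have hμL : G₁ ∉ IwasawaAlgebra.augIdealP p := not_mem_augIdealP_of_norm_coeff_eq_one hG₁ hcert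
  -- §6 (i) with the span clause: some GENUINE Euler-system class is not divisible by `p`
  obtain ⟨s, hs, hsp⟩ := K.exists_isEulerSystemClass_notMem hirr hG₁ hμL
  -- the core under image facts (γ-keyed, unconditional)
  obtain ⟨J, hJ⟩ := CoreAssembly.coreIrr_anyReduction_holds W p κ γ I hp2 hirr hSC hIF hκ hγ ⟨s, hs, hsp⟩
  haveI : Finite (Y'.X ⧸ (IwasawaAlgebra.augIdealP p • (⊤ : Submodule (IwasawaAlgebra p) Y'.X))) :=
    Y'.finite_quotient_augIdealP_of_finite_pTorsion
      (W.finite_fineSelmerInfty_pTorsion_of_forall_iterate_eq_zero κ hγ hJ)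
  -- bookkeeping at `𝔭 = (p)`
  let 𝔭 : PrimeSpectrum (IwasawaAlgebra p) :=
    ⟨IwasawaAlgebra.augIdealP p, IwasawaAlgebra.isPrime_augIdealP_holds p⟩
  have hY0 : Module.lengthAt (IwasawaAlgebra p) Y'.X 𝔭 = 0 :=
    Summit.BirchSwinnertonDyer.BirchSwinnertonDyer.Rank1Residual.KatoMuSkeleton.lengthAt_eq_zero_of_finite_quotient_p
      (M := Y'.X) 𝔭 rfl
  have hX0' : Module.lengthAt (IwasawaAlgebra p) D'.X 𝔭 = 0 :=
    le_antisymm ((K.lengthAt_X_le_lengthAt_fine hirr hG₁ hμL 𝔭 rfl).trans hY0.le) bot_le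
  -- back to the γ-datum: `(p)` is a fixed point of `ι` on `Spec Λ`
  change Module.lengthAt (IwasawaAlgebra p) D.X 𝔭 = 0
  rw [← IwasawaAlgebra.comap_invol_eq_self_of_asIdeal_eq_augIdealP p 𝔭 rfl, hlenD 𝔭]
  exact hX0'

/-! ## §2 `μ = 0` from §1 -/

/-- **`μ(X(E/ℚ_∞)) = 0` at every ODD good ordinary prime with `E[p]` irreducible — `ρ̄_{E,p}` onto or not, CM or not —
given one unit coefficient of `L_p(f, α)`, modulo the PRINT-EXACT contragredient ZETA SIDE ZSᶜ ALONE.**  The statement of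
`smallImageMuTransfer_mu_eq_zero_of_irr_of_fineZetaContra` (p615445) VERBATIM (conclusion `D.mu = 0` for every γ-keyed
datum `D`) with the input re-keyed F1ᶜ ↦ ZSᶜ; from §1 by `muInvariant = (length_(p)).toNat`.  Conditional on ZSᶜ only.
[cite: Kato2004Asterisque, (14.9.3) (p. 240) and §17.13 (pp. 279–280)] [cite: GreenbergVatsal2000, Prop. 3.7] -/
theorem smallImageMuTransfer_mu_eq_zero_of_irr_of_zetaSideContra (hZSc : exists_zetaSideInputs_contra) :
    ∀ (W : WeierstrassCurve ℚ) [W.IsElliptic] [W.IsGloballyMinimal] (p : ℕ) [Fact p.Prime]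
      {N : ℕ} [NeZero N] (f : CuspForm (Gamma0 N) 2),
      p ≠ 2 → W.HasGoodReductionAtPrime p → ¬ (p : ℤ) ∣ W.frobeniusTrace p →
      W.HasIrreducibleModPGaloisRep p → IsNewformOf W f →
      (∃ n : ℕ, ‖PowerSeries.coeff n (padicLFunction f (unitRoot W p : ℚ_[p]))‖ = 1) →
      ∀ (κ : ZpExtension ℚ p) (γ : absoluteGaloisGroup ℚ),
        κ.IsCyclotomic → κ.IsTopGenerator γ → IsCyclotomicVariable p γ →
        ∀ D : W.SelmerDualData κ γ, D.mu = 0 := by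
  intro W _ _ p _ N _ f hp2 hgood hap hirr hf hcert κ γ hκ hγ hγ' D
  have hX := smallImageMuTransfer_lengthAt_selmerDual_eq_zero_of_irr_of_zetaSideContra hZSc W p f hp2 hgood hap
    hirr hf hcert κ γ hκ hγ hγ' D
  change muInvariant p D.X = 0
  rw [muInvariant_eq_toNat_lengthAt p D.X
    ⟨IwasawaAlgebra.augIdealP p, IwasawaAlgebra.isPrime_augIdealP_holds p⟩ rfl, hX]
  rfl

/-! ## §3 Junk-immunity modulo ZSᶜ: `X(E/ℚ_∞)` is `Λ`-torsion and finitely generated over `ℤ_p` -/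

/-- **`X(E/ℚ_∞)` is a TORSION `Λ`-module (`D.IsTorsion`)** at every ODD good ordinary prime with `E[p]` irreducible — any
image — given one unit coefficient of `L_p(f, α)`, modulo the print-exact ZSᶜ ALONE (gen 3's
`…selmerDual_isTorsion_of_irr_of_zetaSide`, p613345, re-keyed ZS ↦ ZSᶜ): from §1, every `x ∈ X` is killed by some `s ∉ (p)`,
a non-zero-divisor of the domain `Λ`.  In print: Kato Thm. 17.4 (1); here a by-product of the `μ`-argument.  The kernel
certificate that `D.mu = 0` is NOT the junk value of `muInvariant` on a non-torsion module.  Conditional on ZSᶜ only.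
[cite: Kato2004Asterisque, Thm. 17.4 (1) (p. 273) and §17.13 (pp. 279–280)] [cite: GreenbergVatsal2000, Prop. 3.7] -/
theorem smallImageMuTransfer_selmerDual_isTorsion_of_irr_of_zetaSideContra (hZSc : exists_zetaSideInputs_contra) :
    ∀ (W : WeierstrassCurve ℚ) [W.IsElliptic] [W.IsGloballyMinimal] (p : ℕ) [Fact p.Prime]
      {N : ℕ} [NeZero N] (f : CuspForm (Gamma0 N) 2),
      p ≠ 2 → W.HasGoodReductionAtPrime p → ¬ (p : ℤ) ∣ W.frobeniusTrace p →
      W.HasIrreducibleModPGaloisRep p → IsNewformOf W f →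
      (∃ n : ℕ, ‖PowerSeries.coeff n (padicLFunction f (unitRoot W p : ℚ_[p]))‖ = 1) →
      ∀ (κ : ZpExtension ℚ p) (γ : absoluteGaloisGroup ℚ),
        κ.IsCyclotomic → κ.IsTopGenerator γ → IsCyclotomicVariable p γ →
        ∀ D : W.SelmerDualData κ γ, D.IsTorsion := by
  intro W _ _ p _ N _ f hp2 hgood hap hirr hf hcert κ γ hκ hγ hγ' D
  have hX := smallImageMuTransfer_lengthAt_selmerDual_eq_zero_of_irr_of_zetaSideContra hZSc W p f hp2 hgood hap
    hirr hf hcert κ γ hκ hγ hγ' D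
  -- `X_(p) = 0`: every element is killed by some `s ∉ (p)`
  rw [Module.lengthAt_eq_zero_iff, LocalizedModule.subsingleton_iff] at hX
  intro x
  obtain ⟨s, hs, hsx⟩ := hX x
  have hs0 : s ≠ 0 := fun h0 ↦ hs (h0 ▸ (IwasawaAlgebra.augIdealP p).zero_mem)
  exact ⟨⟨s, mem_nonZeroDivisors_of_ne_zero hs0⟩, hsx⟩

/-- **`X(E/ℚ_∞)` is FINITELY GENERATED OVER `ℤ_p`** (`Module.Finite ℤ_[p]` of `RestrictScalars ℤ_[p] Λ X` — Greenberg's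
form of `μ = 0`, LNM 1716 §1 p. 60 and Conj. 1.11) at every ODD good ordinary prime with `E[p]` irreducible — any image —
given one unit coefficient of `L_p(f, α)`, modulo the print-exact ZSᶜ ALONE (gen 3's
`…selmerDual_moduleFinite_padicInt_of_irr_of_zetaSide`, p613345, re-keyed ZS ↦ ZSᶜ): from §1 by the tree's
`finite_of_lengthAt_eq_zero` (Washington §13.2).  Conditional on ZSᶜ only; nothing asserted.
[cite: GreenbergLNM1716, §1 (p. 60) and Conj. 1.11] [cite: Washington1997, §13.2] [cite: Kato2004Asterisque, §17.13 (pp. 279–280)] -/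
theorem smallImageMuTransfer_selmerDual_moduleFinite_padicInt_of_irr_of_zetaSideContra
    (hZSc : exists_zetaSideInputs_contra) :
    ∀ (W : WeierstrassCurve ℚ) [W.IsElliptic] [W.IsGloballyMinimal] (p : ℕ) [Fact p.Prime]
      {N : ℕ} [NeZero N] (f : CuspForm (Gamma0 N) 2),
      p ≠ 2 → W.HasGoodReductionAtPrime p → ¬ (p : ℤ) ∣ W.frobeniusTrace p →
      W.HasIrreducibleModPGaloisRep p → IsNewformOf W f →
      (∃ n : ℕ, ‖PowerSeries.coeff n (padicLFunction f (unitRoot W p : ℚ_[p]))‖ = 1) →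
      ∀ (κ : ZpExtension ℚ p) (γ : absoluteGaloisGroup ℚ),
        κ.IsCyclotomic → κ.IsTopGenerator γ → IsCyclotomicVariable p γ →
        ∀ D : W.SelmerDualData κ γ,
          Module.Finite ℤ_[p] (RestrictScalars ℤ_[p] (IwasawaAlgebra p) D.X) := by
  intro W _ _ p _ N _ f hp2 hgood hap hirr hf hcert κ γ hκ hγ hγ' D
  have hX := smallImageMuTransfer_lengthAt_selmerDual_eq_zero_of_irr_of_zetaSideContra hZSc W p f hp2 hgood hap
    hirr hf hcert κ γ hκ hγ hγ' D
  haveI : Module.Finite (IwasawaAlgebra p) D.X :=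
    WeierstrassCurve.SelmerDualData.module_finite_of_isCyclotomic W κ hκ D hγ
  -- the compatible `ℤ_p`-structure on `X` (= the one of `RestrictScalars ℤ_[p] Λ X`, by `Module.compHom`)
  letI : Module ℤ_[p] D.X := Module.compHom D.X (algebraMap ℤ_[p] (IwasawaAlgebra p))
  haveI : IsScalarTower ℤ_[p] (IwasawaAlgebra p) D.X := IsScalarTower.of_compHom ℤ_[p] _ D.X
  exact finite_of_lengthAt_eq_zero p D.X
    ⟨IwasawaAlgebra.augIdealP p, IwasawaAlgebra.isPrime_augIdealP_holds p⟩ rfl hX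

/-! ## §4 The parent item by name, modulo the print-exact zeta side ALONE -/

/-- **The parent crux `MuTransfer` (stmt-BirchSwinnertonDyer-19629), literally the route decl, modulo the PRINT-EXACT
contragredient ZETA SIDE ZSᶜ ALONE** (`Kato2004.exists_zetaSideInputs_contra`: the zeta-element construction with Thm. 12.6 +
Ex. 13.3, Thm. 16.6 (2) + 17.5 read at `(p)`, Prop. 17.11, (17.13.1) at `P`, (14.9.3), duals contragredient).  Implied by
F1ᶜ (`Kato2004.exists_zetaSideInputs_contra_of_fineQuotient_zeta_contra`), hence by the registered stub of line `f1_fine`.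
Conditional; the item stays open until ZSᶜ (or F1ᶜ) is a theorem; BSD not advanced.
[cite: Kato2004Asterisque, Thm. 12.6 (p. 222), Thm. 16.6 (2) (p. 271), §17.3 (p. 273), Prop. 17.11 (p. 277) and §17.13 (pp. 279–280)]
[cite: GreenbergVatsal2000, Prop. 3.7] [cite: Greenberg1989, §0 pp. 101–102 (S^ι)] -/
theorem smallImageMuTransfer_MuTransfer_of_zetaSideContra (hZSc : exists_zetaSideInputs_contra) :
    Summit.BirchSwinnertonDyer.BirchSwinnertonDyer.Theses.SmallImageMuTransfer.MuTransfer := by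
  unfold Summit.BirchSwinnertonDyer.BirchSwinnertonDyer.Theses.SmallImageMuTransfer.MuTransfer
    Summit.BirchSwinnertonDyer.BirchSwinnertonDyer.Rank1Residual.KatoMuTransfer
  intro W _ _ p _ N _ f hp hgood hap hirr hf hcert κ γ hκ hγ hγ' D
  exact smallImageMuTransfer_mu_eq_zero_of_irr_of_zetaSideContra hZSc W p f (by omega) hgood hap hirr hf hcert
    κ γ hκ hγ hγ' D

/-- **The same statement under the tree's name `Rank1Residual.KatoMuTransfer`**, modulo the print-exact ZSᶜ alone.
[cite: Kato2004Asterisque, §17.3 (p. 273) and §17.13 (pp. 279–280)] [cite: Greenberg1989, §0 pp. 101–102 (S^ι)] -/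
theorem smallImageMuTransfer_katoMuTransfer_of_zetaSideContra (hZSc : exists_zetaSideInputs_contra) :
    Summit.BirchSwinnertonDyer.BirchSwinnertonDyer.Rank1Residual.KatoMuTransfer :=
  smallImageMuTransfer_MuTransfer_of_zetaSideContra hZSc

end Summit.BirchSwinnertonDyer.BirchSwinnertonDyer.Theorems

end
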